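import Summits.BirchSwinnertonDyer.Rank1Residual.X4.KuriharaAdditiveLevelLoweringClosed
import Summits.BirchSwinnertonDyer.Rank1Residual.X4.KuriharaLevelLoweringModPowMulti
import HarnessLib

/-!
# The ADDITIVE (two-prime, `τ`-system) level-lowering certificate modulo `p^e` forces `δ̃_n^{(k)} = 0` for every `k ≤ e`, `n ∈ 𝒩_k`, hence `∂^{(∞)}(δ̃) ≥ e` — the socket for the joint exponent `e = e₁ + e₂` (cell `b2b-bsdres`, seat additive-p4 gen 31, line V51′/V52-B; CLASS-CLOSURE §3.1 N11 SPREAD rows)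

HONEST FRAMING (verbatim, cell `b2b-bsdres`): the goal of the cell is to DELETE the COMBINATION-SHAPED
residual classes for ALL analytic-rank `≤ 1` curves over `ℚ` — "full BSD formula for every rank `≤ 1`
curve in class `C`" assembled STRICTLY from published theorems — so that the rank-`≤ 1` remainder
becomes exactly the CONSTRUCTION-SHAPED classes, which are TYPED (missing-input Props), NOT attempted;
this is not "finishing BSD". This file: a research-route KERNEL THEOREM (pure algebra over the tree's
`kuriharaNumber`; no named fact, no conjecture, nothing booked; X4 stays CONSTRUCTION-SHAPED; no
Literature fact is minted; labels unchanged).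

## What is proved

Gen 29/30's certificates (`PlusSymbolLevelLowersModAt[On]`) use `T_q`-EIGEN old components and are
measured to stop at `max_ℓ ord_p c_ℓ` (E8). The component-free decomposition at two defect primes
reaches the SUM `e₁ + e₂` (E8 FREE, 21/21 rows) and carries a `τ`-SYSTEM (E9b, 5/5 rows). This file
is the consumer of the now-unconditional two-prime theorem (`kuriharaSum_twoPrime_eq_zero`,
`X4/KuriharaAdditiveLevelLoweringClosed.lean`):

* `PlusSymbolLevelLowersAdditivelyModAt W p f m ℓ₁ ℓ₂` — the ADDITIVE CERTIFICATE modulo `m`: families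
  `Dα U`, `Dβ U`, `τ U : ℚ → ℤ/m` over the finite sets `U` of Kolyvagin primes (`q ∈ 𝒫_1(E,p)`),
  periodic, with the Hecke-derivative relations `H_q(D U) = a_q·D U + D(U ∪ q)` (eigenvalue `a_q(E)
  mod m`), the `τ`-system identities `Dα U = τ_U − τ_U∘[ℓ₂]`, `Dβ U = −(τ_U − τ_U∘[ℓ₁])` (`U ≠ ∅`),
  and the decomposition `\overline{[r]⁺_f} = (Dα ∅ r − Dα ∅ (ℓ₁r)) + (Dβ ∅ r − Dβ ∅ (ℓ₂r))`.
  The eigen certificate on `{ℓ₁, ℓ₂}` is the special case `τ = 0`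
  (`plusSymbolLevelLowersAdditivelyModAt_of_modAtOn_pair`). A predicate; nothing asserted.
* **`kuriharaNumber_eq_zero_of_plusSymbolLevelLowersAdditivelyModAt`** — the certificate at `m = p^e`
  with `ℓ₁, ℓ₂ ∣ N_E`, `k ≤ e`, `n ∈ 𝒩_k(E,p)`, `p`-integral symbols, SURJECTIVE `ψ` ⟹
  `kuriharaNumber f (p^k) n ψ = 0` (reduce along `ℤ/p^e → ℤ/p^k`, where `a_q ↦ 2` at the primes of
  `n`, and apply the two-prime theorem; surjective `ψ_q` take the value `1`).
* `kuriharaDivisibleAt_of_…`, **`le_kuriharaPartialInfty_of_plusSymbolLevelLowersAdditivelyModAt`**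
  (`∂^{(∞)}(δ̃) ≥ e`), `pow_min_dvd_kuriharaNumber_of_…` — for the newform of an elliptic curve with
  `E[p]` irreducible, `p` odd, conductor `= N`: the inputs `α = e` of the one-factor socket
  (`X4/KimDefectParity.lean`) and of Kim's Thm. 1.8 (6) at the JOINT exponent.

Where the certificate comes from on a row (not asserted here): the seat's instrument E9b (`thjoint`,
FREE decomposition mod `p^{e₁+e₂}` plus a common `τ` on Hecke generators) — EVIDENCE per pair, never a
Literature fact.

## References

* B. Mazur, J. Tate, J. Teitelbaum, Invent. Math. 84 (1986), §I.4 (4.2). [cite: MazurTateTeitelbaum1986Invent, §I.4 (4.2)]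
* M. Kurihara, Contrib. Math. Comput. Sci. 7 (2014) 317–356, §1.1 (1)–(2). [cite: Kurihara2014, §1.1]
* C.-H. Kim, Amer. J. Math. 148 (2026), §1.4.3, §1.5.1, Thm. 1.9 (6), Conj. 1.10. [cite: Kim2022StructureSelmer, §1.5.1, Conj. 1.10 and Rem. 6.2 (PDF pp. 7–8, 31)]
* R. Pollack, T. Weston, Compos. Math. 147 (2011) 1353–1381. [cite: PollackWeston2011, Thm. 6.11 of arXiv:math/0610694 (quantitative level lowering, restated as Kim–Ota 2019 Thm. 1.2); provenance, not an input here (printed for p ≥ 5, p ∤ N square-free; the X4 rows are the ANALOGUE at p ∣ N)]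
* C.-H. Kim, K. Ota, arXiv:1905.02926, Conj. 1.1, Thm. 1.3. [cite: KimOta2019CongruenceIdeals, Conj. 1.1 and Thm. 1.3 (text chunk p0003); provenance, not an input here (p ∤ N and N⁻ square-free there)]
-/

noncomputable section

open scoped MatrixGroups ModularForm

open CongruenceSubgroup Finset

open Literature.NumberTheory.EllipticCurves Literature.NumberTheory.EllipticCurves.ModularForms

open Literature.NumberTheory.DiophantineGeometry.Dioph (ratModP)

namespace Summit.BirchSwinnertonDyer.Rank1Residual.LevelLowering

variable {R : Type*}

/-! ### §1 Transport of the Hecke transform along a ring homomorphism -/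

section Transport

/-- `H_q (φ ∘ μ) = φ ∘ H_q μ` for a ring homomorphism `φ` of coefficients. [cite: MazurTateTeitelbaum1986Invent, §I.4 (4.2)] -/
theorem heckeTransform_map [CommRing R] {S : Type*} [CommRing S] (φ : R →+* S) (q : ℕ)
    (μ : ℚ → R) (r : ℚ) : heckeTransform q (φ ∘ μ) r = φ (heckeTransform q μ r) := by
  simp only [heckeTransform, Function.comp_apply, map_add, map_sum]

end Transport

/-! ### §2 The additive certificate at a modulus `m` -/

section ModPow

variable (W : WeierstrassCurve ℚ) [W.IsGloballyMinimal] (p : ℕ) {N : ℕ} (f : CuspForm (Gamma0 N) 2)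

/-- **THE ADDITIVE LEVEL-LOWERING CERTIFICATE at two primes `ℓ₁, ℓ₂`, MODULO `m`**, in the currency
of the tree's `kuriharaNumber` (`\overline{q} = ratModP m q`): families `Dα U, Dβ U, τ U : ℚ → ℤ/m`
indexed by finite sets `U` (of Kolyvagin primes `q ∈ 𝒫_1(E,p)`: `q ∤ Np`, `q ≡ 1`, `a_q ≡ 2 (mod p)`),
all periodic, with (i) the Hecke-derivative relations `H_q (D U) = a_q(E)·D U + D(U ∪ {q})` for
`Dα`, `Dβ` (all `U`) and `τ` (`U ≠ ∅`) at every Kolyvagin `q ∉ U` — so `Dα U = (∏_{q∈U}(T_q − a_q)) α`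
for `α = Dα ∅`; (ii) the `τ`-SYSTEM identities `Dα U = τ_U − τ_U∘[ℓ₂]`, `Dβ U = −(τ_U − τ_U∘[ℓ₁])`
on the non-empty sets of Kolyvagin primes; (iii) the decomposition of the reduced plus symbol
`\overline{[r]⁺_f} = (Dα ∅ r − Dα ∅ (ℓ₁ r)) + (Dβ ∅ r − Dβ ∅ (ℓ₂ r))`. With `τ = 0` and `Dα U = 0`
(`U ≠ ∅`) this is the eigen certificate on `{ℓ₁, ℓ₂}`. MEASURED (cell instruments E8 FREE / E9b, gen
30; EVIDENCE): available at `m = p^{e₁+e₂}`, `e_i = ord_p c_{ℓ_i}`, on every decided row, where the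
eigen certificate stops at `p^{max e_i}`. A predicate; nothing asserted.
[cite: Kim2022StructureSelmer, §1.2.2, §1.4.3 and Conj. 1.10 (PDF pp. 5, 7, 8)]
[cite: PollackWeston2011, Thm. 6.11 of arXiv:math/0610694 (quantitative level lowering, restated as Kim–Ota 2019 Thm. 1.2); provenance, not an input here (printed for p ≥ 5, p ∤ N square-free; the X4 rows are the ANALOGUE at p ∣ N)] [cite: MazurTateTeitelbaum1986Invent, §I.4 (4.2)] -/
def PlusSymbolLevelLowersAdditivelyModAt (m : ℕ) (ℓ₁ ℓ₂ : ℕ) : Prop :=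
  ∃ Dα Dβ τ : Finset ℕ → ℚ → ZMod m,
    (∀ U, IsPeriodic (Dα U)) ∧ (∀ U, IsPeriodic (Dβ U)) ∧ (∀ U, IsPeriodic (τ U)) ∧
    (∀ (U : Finset ℕ) (q : ℕ), Kato.IsKolyvaginPrime W p 1 q → q ∉ U → ∀ r : ℚ,
      heckeTransform q (Dα U) r = (W.frobeniusTrace q : ZMod m) * Dα U r + Dα (insert q U) r) ∧
    (∀ (U : Finset ℕ) (q : ℕ), Kato.IsKolyvaginPrime W p 1 q → q ∉ U → ∀ r : ℚ,
      heckeTransform q (Dβ U) r = (W.frobeniusTrace q : ZMod m) * Dβ U r + Dβ (insert q U) r) ∧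
    (∀ (U : Finset ℕ), U.Nonempty → ∀ (q : ℕ), Kato.IsKolyvaginPrime W p 1 q → q ∉ U → ∀ r : ℚ,
      heckeTransform q (τ U) r = (W.frobeniusTrace q : ZMod m) * τ U r + τ (insert q U) r) ∧
    (∀ U : Finset ℕ, U.Nonempty → (∀ q ∈ U, Kato.IsKolyvaginPrime W p 1 q) →
      ∀ r : ℚ, Dα U r = τ U r - τ U (ℓ₂ * r)) ∧
    (∀ U : Finset ℕ, U.Nonempty → (∀ q ∈ U, Kato.IsKolyvaginPrime W p 1 q) →
      ∀ r : ℚ, Dβ U r = -(τ U r - τ U (ℓ₁ * r))) ∧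
    ∀ r : ℚ, ratModP m (ratPlusSymbol f r) =
      (Dα ∅ r - Dα ∅ (ℓ₁ * r)) + (Dβ ∅ r - Dβ ∅ (ℓ₂ * r))

variable {W p f}

/-- **The eigen certificate on `{ℓ₁, ℓ₂}` (`ℓ₁ ≠ ℓ₂`) is an additive certificate** (with `τ = 0` and
all higher derivatives `0`): the additive predicate generalises gen 30's `PlusSymbolLevelLowersModAtOn`.
[cite: Kim2022StructureSelmer, §1.4.3 (PDF p. 7)] -/
theorem plusSymbolLevelLowersAdditivelyModAt_of_modAtOn_pair {m ℓ₁ ℓ₂ : ℕ} (hne : ℓ₁ ≠ ℓ₂)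
    (h : PlusSymbolLevelLowersModAtOn W p f m {ℓ₁, ℓ₂}) :
    PlusSymbolLevelLowersAdditivelyModAt W p f m ℓ₁ ℓ₂ := by
  classical
  obtain ⟨μ, hμ, hH, hsym⟩ := h
  have h1 : ℓ₁ ∈ ({ℓ₁, ℓ₂} : Finset ℕ) := by simp
  have h2 : ℓ₂ ∈ ({ℓ₁, ℓ₂} : Finset ℕ) := by simp
  refine ⟨fun U ↦ if U = ∅ then μ ℓ₁ else fun _ ↦ 0, fun U ↦ if U = ∅ then μ ℓ₂ else fun _ ↦ 0,
    fun _ _ ↦ 0, ?_, ?_, fun _ ↦ isPeriodic_zero, ?_, ?_, ?_, ?_, ?_, ?_⟩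
  · intro U
    by_cases hU : U = ∅
    · simp only [hU, if_true]; exact hμ ℓ₁ h1
    · simp only [hU, if_false]; exact isPeriodic_zero
  · intro U
    by_cases hU : U = ∅
    · simp only [hU, if_true]; exact hμ ℓ₂ h2
    · simp only [hU, if_false]; exact isPeriodic_zero
  · intro U q hq _ r
    have hne' : insert q U ≠ ∅ := (Finset.insert_nonempty q U).ne_empty
    by_cases hU : U = ∅
    · simp only [hU, if_true, Finset.insert_empty, Finset.singleton_ne_empty, if_false, add_zero]
      exact hH ℓ₁ h1 q hq r
    · simp only [hU, hne', if_false, heckeTransform_zero, mul_zero, add_zero]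
  · intro U q hq _ r
    have hne' : insert q U ≠ ∅ := (Finset.insert_nonempty q U).ne_empty
    by_cases hU : U = ∅
    · simp only [hU, if_true, Finset.insert_empty, Finset.singleton_ne_empty, if_false, add_zero]
      exact hH ℓ₂ h2 q hq r
    · simp only [hU, hne', if_false, heckeTransform_zero, mul_zero, add_zero]
  · intro U _ q _ _ r
    simp only [heckeTransform_zero, mul_zero, add_zero]
  · intro U hU _ r
    simp only [hU.ne_empty, if_false, sub_self]
  · intro U hU _ r
    simp only [hU.ne_empty, if_false, sub_self, neg_zero]
  · intro r
    rw [hsym r, Finset.sum_pair hne]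
    simp only [if_true]

/-- **EVERY mod-`p^k` Kurihara number vanishes under the additive mod-`p^e` certificate, `k ≤ e`**:
if the plus symbol of `f` level-lowers ADDITIVELY modulo `p^e` at two divisors `ℓ₁, ℓ₂` of `N_E`,
`n ∈ 𝒩_k(E,p)` with `k ≤ e`, the symbols `[a/n]⁺_f` are `p`-integral and the discrete logarithms
`ψ_q` (`q ∣ n`) are surjective onto `ℤ/p^k`, then `kuriharaNumber f (p^k) n ψ = 0`. Proof: reduce the
families along `ℤ/p^e → ℤ/p^k` (at the primes of `n`, `a_q ↦ 2`), restrict the admissible primes to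
`𝒫_k(E,p)` (prime to `ℓ_i ∣ N_E`), and apply `kuriharaSum_twoPrime_eq_zero` (lemma S needs `ψ_q` to
take the value `1`, which surjectivity gives). [cite: Kim2022StructureSelmer, §1.2.2 and §1.4.3 (PDF pp. 5, 7)]
[cite: Kurihara2014, §1.1 (1)–(2)] [cite: PollackWeston2011, Thm. 6.11 of arXiv:math/0610694 (quantitative level lowering, restated as Kim–Ota 2019 Thm. 1.2); provenance, not an input here (printed for p ≥ 5, p ∤ N square-free; the X4 rows are the ANALOGUE at p ∣ N)] -/
theorem kuriharaNumber_eq_zero_of_plusSymbolLevelLowersAdditivelyModAt [Fact p.Prime] {e ℓ₁ ℓ₂ : ℕ}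
    (hcert : PlusSymbolLevelLowersAdditivelyModAt W p f (p ^ e) ℓ₁ ℓ₂)
    (hℓ₁ : ℓ₁ ∣ W.conductorNorm ℤ) (hℓ₂ : ℓ₂ ∣ W.conductorNorm ℤ)
    {k : ℕ} (hk : k ≤ e) {n : ℕ} [NeZero n] (hn : Kato.IsKolyvaginProduct W p k n)
    (hden : ∀ a : (ZMod n)ˣ, ¬ p ∣ (ratPlusSymbol f (((a : ZMod n).val : ℚ) / n)).den)
    (ψ : (q : ℕ) → (ZMod q)ˣ →* Multiplicative (ZMod (p ^ k)))
    (hψ : ∀ q ∈ n.primeFactors, Function.Surjective (ψ q)) :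
    kuriharaNumber f (p ^ k) n ψ = 0 := by
  rcases Nat.eq_zero_or_pos k with rfl | hk1
  · haveI : Subsingleton (ZMod (p ^ 0)) := ZMod.subsingleton_iff.mpr (pow_zero p)
    exact Subsingleton.elim _ _
  obtain ⟨Dα, Dβ, τ, hpα, hpβ, hpτ, hDα, hDβ, hDτ, h1, h2, hsym⟩ := hcert
  set φ : ZMod (p ^ e) →+* ZMod (p ^ k) := ZMod.castHom (pow_dvd_pow p hk) (ZMod (p ^ k))
    with hφ
  -- admissible primes: `𝒫_k(E, p)`; they are prime to `ℓ₁, ℓ₂ ∣ N_E` and have `a_q ↦ 2` in `ℤ/p^k`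
  have hP : ∀ q, Kato.IsKolyvaginPrime W p k q → q.Prime ∧ q.Coprime ℓ₁ ∧ q.Coprime ℓ₂ := by
    intro q hq
    refine ⟨hq.prime, (Nat.Prime.coprime_iff_not_dvd hq.prime).mpr fun h ↦ ?_,
      (Nat.Prime.coprime_iff_not_dvd hq.prime).mpr fun h ↦ ?_⟩
    exacts [hq.not_dvd_conductorNorm (dvd_trans h hℓ₁), hq.not_dvd_conductorNorm (dvd_trans h hℓ₂)]
  have htwo : ∀ q, Kato.IsKolyvaginPrime W p k q → φ (W.frobeniusTrace q : ZMod (p ^ e)) = 2 := by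
    intro q hq
    rw [map_intCast]
    exact (Kato.isKolyvaginPrime_iff_zmod.mp hq).2.2.2
  have hone : ∀ q, Kato.IsKolyvaginPrime W p k q → Kato.IsKolyvaginPrime W p 1 q :=
    fun q hq ↦ hq.mono hk1
  -- the reduced families satisfy the hypotheses of the two-prime theorem over `ℤ/p^k`
  have hred : ∀ (D : Finset ℕ → ℚ → ZMod (p ^ e)) (U : Finset ℕ) (q : ℕ),
      Kato.IsKolyvaginPrime W p k q →
      (∀ r : ℚ, heckeTransform q (D U) r =
        (W.frobeniusTrace q : ZMod (p ^ e)) * D U r + D (insert q U) r) →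
      ∀ r : ℚ, heckeTransform q (φ ∘ D U) r = 2 * (φ ∘ D U) r + (φ ∘ D (insert q U)) r := by
    intro D U q hq h r
    rw [heckeTransform_map, h r, map_add, map_mul, htwo q hq]
    rfl
  have hψ' : ∀ q ∈ n.primeFactors, ∃ u : (ZMod q)ˣ, ψ q u = Multiplicative.ofAdd 1 :=
    fun q hq ↦ hψ q hq _
  have hmain := kuriharaSum_twoPrime_eq_zero ψ hP (fun U ↦ φ ∘ Dα U) (fun U ↦ φ ∘ Dβ U)
    (fun U ↦ φ ∘ τ U) (fun U ↦ (hpα U).map φ) (fun U ↦ (hpβ U).map φ) (fun U ↦ (hpτ U).map φ)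
    (fun U q hq hqU ↦ hred Dα U q hq (hDα U q (hone q hq) hqU))
    (fun U q hq hqU ↦ hred Dβ U q hq (hDβ U q (hone q hq) hqU))
    (fun U hU q hq hqU ↦ hred τ U q hq (hDτ U hU q (hone q hq) hqU))
    (fun U hU hUP r ↦ by
      simp only [Function.comp_apply, h1 U hU (fun q hq ↦ hone q (hUP q hq)) r, map_sub])
    (fun U hU hUP r ↦ by
      simp only [Function.comp_apply, h2 U hU (fun q hq ↦ hone q (hUP q hq)) r, map_sub, map_neg])
    n hn.squarefree hn.2 hψ'
  have hterm : ∀ a : (ZMod n)ˣ,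
      ratModP (p ^ k) (ratPlusSymbol f (((a : ZMod n).val : ℚ) / n)) =
        ((φ ∘ Dα ∅) ((((a : ZMod n).val : ℕ) : ℚ) / n) -
          (φ ∘ Dα ∅) ((ℓ₁ : ℚ) * ((((a : ZMod n).val : ℕ) : ℚ) / n))) +
        ((φ ∘ Dβ ∅) ((((a : ZMod n).val : ℕ) : ℚ) / n) -
          (φ ∘ Dβ ∅) ((ℓ₂ : ℚ) * ((((a : ZMod n).val : ℕ) : ℚ) / n))) := by
    intro a
    rw [← Additive.KuriharaReduction.castHom_ratModP_pow p hk (hden a), hsym]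
    simp only [Function.comp_apply, map_add, map_sub]
    rfl
  rw [kuriharaNumber_def]
  refine (Finset.sum_congr rfl fun a _ ↦ ?_).trans hmain
  rw [prod_attach_toAdd_eq_weight, hterm a]

/-- **A SINGLE-prime eigen certificate is an additive certificate** at `(ℓ₁, ℓ₂)` for any second
index `ℓ₂ ≠ ℓ₁` (`Dβ = 0`, `τ = 0`): the additive predicate dominates gen 29's
`PlusSymbolLevelLowersModAt` as well (via gen 30's `plusSymbolLevelLowersModAtOn_of_modAt` and
`plusSymbolLevelLowersAdditivelyModAt_of_modAtOn_pair`), so every consumer of this file applies to the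
single-prime certificates with `e = ord_p c_ℓ`. [cite: Kim2022StructureSelmer, §1.4.3 (PDF p. 7)] -/
theorem plusSymbolLevelLowersAdditivelyModAt_of_modAt {m ℓ₁ ℓ₂ : ℕ} (hne : ℓ₁ ≠ ℓ₂)
    (h : PlusSymbolLevelLowersModAt W p f m ℓ₁) :
    PlusSymbolLevelLowersAdditivelyModAt W p f m ℓ₁ ℓ₂ :=
  plusSymbolLevelLowersAdditivelyModAt_of_modAtOn_pair hne
    (plusSymbolLevelLowersModAtOn_of_modAt (by simp) h)

end ModPow

/-! ### §3 Application to the newform of an elliptic curve: `∂^{(∞)}(δ̃) ≥ e` at the joint exponent -/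

section Application

variable {W : WeierstrassCurve ℚ} [W.IsElliptic] [W.IsGloballyMinimal] {p : ℕ} [Fact p.Prime]

/-- **`δ̃_n ∈ p^e ℤ_p/I_nℤ_p` at every level** (`KuriharaDivisibleAt … n e`) for the newform `D.f` of an
elliptic curve with `E[p]` irreducible, `p` odd, conductor `= N`, under the ADDITIVE mod-`p^e`
certificate at two divisors `ℓ₁, ℓ₂` of `N_E`.
[cite: Kim2022StructureSelmer, §1.4.3 and §1.5.1 (PDF p. 7), Def. 2.13 (PDF p. 14)] -/
theorem kuriharaDivisibleAt_of_plusSymbolLevelLowersAdditivelyModAt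
    (hp2 : p ≠ 2) (hirr : W.HasIrreducibleModPGaloisRep p) {N : ℕ} [NeZero N]
    (D : ModularParametrizationData W N) (hN : W.conductorNorm ℤ = N) {e ℓ₁ ℓ₂ : ℕ}
    (hcert : PlusSymbolLevelLowersAdditivelyModAt W p D.f (p ^ e) ℓ₁ ℓ₂)
    (hℓ₁ : ℓ₁ ∣ W.conductorNorm ℤ) (hℓ₂ : ℓ₂ ∣ W.conductorNorm ℤ)
    (n : ℕ) : KuriharaDivisibleAt W p D.f n e := by
  intro k hk hkn ψ hψ
  haveI : NeZero n := ⟨hkn.ne_zero⟩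
  have hcopN : n.Coprime N := by
    have := hkn.coprime
    rw [hN] at this
    exact Nat.Coprime.coprime_dvd_right (dvd_mul_right N p) this
  have hden : ∀ a : (ZMod n)ˣ, ¬ p ∣ (ratPlusSymbol D.f (((a : ZMod n).val : ℚ) / n)).den := by
    intro a
    have hnd := D.isNewformOf.not_dvd_den_ratPlusSymbol_div hp2 hirr hcopN ((a : ZMod n).val : ℤ)
    rwa [Int.cast_natCast] at hnd
  exact kuriharaNumber_eq_zero_of_plusSymbolLevelLowersAdditivelyModAt hcert hℓ₁ hℓ₂ hk hkn hden ψ hψ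

/-- **`∂^{(∞)}(δ̃) ≥ e` under the ADDITIVE mod-`p^e` certificate** (the tree's `kuriharaPartialInfty`,
cyclic levels) — the input `α = e` of the ONE-FACTOR SOCKET (`X4/KimDefectParity.lean`) at the JOINT
exponent `e = e₁ + e₂` of two defect primes, which the eigen certificates cannot reach (E8: they stop
at `max e_i`); with it the SPREAD rows with `ord_p ∏_v c_v ≤ e₁ + e₂ + 1` enter the socket.
[cite: Kim2022StructureSelmer, §1.5.1 (PDF p. 7) and Conj. 1.10 (PDF p. 8)] -/
theorem le_kuriharaPartialInfty_of_plusSymbolLevelLowersAdditivelyModAt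
    (hp2 : p ≠ 2) (hirr : W.HasIrreducibleModPGaloisRep p) {N : ℕ} [NeZero N]
    (D : ModularParametrizationData W N) (hN : W.conductorNorm ℤ = N) {e ℓ₁ ℓ₂ : ℕ}
    (hcert : PlusSymbolLevelLowersAdditivelyModAt W p D.f (p ^ e) ℓ₁ ℓ₂)
    (hℓ₁ : ℓ₁ ∣ W.conductorNorm ℤ) (hℓ₂ : ℓ₂ ∣ W.conductorNorm ℤ) :
    (e : ℕ∞) ≤ kuriharaPartialInfty W p D.f := by
  refine le_iInf fun i ↦ ?_
  rw [kuriharaPartial_def]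
  refine le_iInf fun n ↦ le_iInf fun _ ↦ le_iInf fun _ ↦ ?_
  exact le_kuriharaDivIndex_of_divisibleAt W p D.f
    (kuriharaDivisibleAt_of_plusSymbolLevelLowersAdditivelyModAt hp2 hirr D hN hcert hℓ₁ hℓ₂ n)

/-- **Kim's universally quantified input at `m = e`**: `p^{min(e,k)} ∣ δ̃_n^{(k)}` for every `k`, every
`n ∈ 𝒩_k` and every surjective `ψ`, under the additive mod-`p^e` certificate.
[cite: Kim2022StructureSelmer, Thm. 1.9 (6) (PDF p. 8), §1.5.1 (PDF p. 7)] -/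
theorem pow_min_dvd_kuriharaNumber_of_plusSymbolLevelLowersAdditivelyModAt
    (hp2 : p ≠ 2) (hirr : W.HasIrreducibleModPGaloisRep p) {N : ℕ} [NeZero N]
    (D : ModularParametrizationData W N) (hN : W.conductorNorm ℤ = N) {e ℓ₁ ℓ₂ : ℕ}
    (hcert : PlusSymbolLevelLowersAdditivelyModAt W p D.f (p ^ e) ℓ₁ ℓ₂)
    (hℓ₁ : ℓ₁ ∣ W.conductorNorm ℤ) (hℓ₂ : ℓ₂ ∣ W.conductorNorm ℤ)
    {k : ℕ} {n : ℕ} [NeZero n] (hn : Kato.IsKolyvaginProduct W p k n)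
    (ψ : (q : ℕ) → (ZMod q)ˣ →* Multiplicative (ZMod (p ^ k)))
    (hψ : ∀ q ∈ n.primeFactors, Function.Surjective (ψ q)) :
    ((p ^ min e k : ℕ) : ZMod (p ^ k)) ∣ kuriharaNumber D.f (p ^ k) n ψ :=
  Kim2026.pow_min_dvd_kuriharaNumber_of_kuriharaDivisibleAt W p hp2 hirr D hN hn
    (kuriharaDivisibleAt_of_plusSymbolLevelLowersAdditivelyModAt hp2 hirr D hN hcert hℓ₁ hℓ₂ n) ψ hψ

end Application

end Summit.BirchSwinnertonDyer.Rank1Residual.LevelLowering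

end
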